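import Summits.ValiantsHypothesis.ValiantsHypothesis.Theorems.GrenetZeonPolySizeQPAlgebraReadOut
import Literature.Computability.AlgebraicComplexity.SumProductLayeredABP
import HarnessLib

/-!
# An entry of a product of affine matrices over a coefficient algebra is an `(m, s)`-representation

Helper file for the crux `AbelianizationQP` (stmt-ValiantsHypothesis-8063) and the piece
`PolySizeQPAlgebra` (stmt-8064) of route `GrenetZeon`; companion of
`GrenetZeonPolySizeQPAlgebraReadOut.lean` and the NON-commuting counterpart of the mechanism lemma
`hasAlgDetRepr_entry_prod_of_commute` (`GrenetZeonAbelianizationQPCommutingProduct.lean`):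

* there, `d` pairwise COMMUTING affine `w × w` matrices give a `(d, w²)`-representation of an
  entry of their product (abelianization: the matrices become the coefficient algebra);
* here, ANY `d` affine `w × w` matrices `M_0, …, M_{d-1}` with entries affine forms over a
  commutative coefficient algebra `R` (`dim_k R ≤ s`) give, for every entry `(u, v)` and every
  `k`-linear read-out `λ : R → k`, a `((d + 1) w + 1, s)`-representation of
  `λ_* ((M_0 ⋯ M_{d-1})_{u v})` (iterated matrix product = layered algebraic branching program on
  the vertex set `{0, …, d} × W`; Valiant's `(1 - N)⁻¹` read-out, `LayeredABPComputes.hasDetRepr`,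
  over the ring `R`).

The two lemmas are the endpoints of the matrix-size / coefficient-dimension trade the crux is
about: a width-`w` program over a `2^b`-dimensional zeon factor is a `(≈ d w, 2^b)`-representation
(this file), a commuting one a `(d, 2^b w²)`-representation (the mechanism lemma).

## Main results

* `blockPath_pow_apply` — powers of the block-superdiagonal adjacency matrix of the layered
  program `{0..d} × W`: `(N^k)_{(i,u),(i',v)} = [i' = i + k] · (M_i ⋯ M_{i+k-1})_{u v}`.
* `layeredABPComputes_listProd_apply` — `((M_0 ⋯ M_{d-1}) u v)` is computed by a layered ABP on
  `(d + 1) · |W|` vertices (every commutative ring of coefficients).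
* `hasAlgDetRepr_listProd_apply_readOut` — the `((d + 1) |W| + 1, s)`-representation of the
  read-out.

This file is route-independent (no `Theses` import).  No stub is closed; `VP ≠ VNP` is not
touched.

## References

* L. G. Valiant, *Completeness classes in algebra*, STOC 1979, §2. [cite: Valiant1979, §2]
* P. Hrubeš, A. Yehudayoff, *Arithmetic complexity in ring extensions*, Theory of Computing 7
  (2011), §2. [cite: HrubesYehudayoff2011, §2]
-/

set_option linter.dupNamespace false

noncomputable section

namespace Summit.ValiantsHypothesis.ValiantsHypothesis.Theorems.GrenetZeonPolySizeQPAlgebra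

open MvPolynomial Matrix
open Literature.Computability.AlgebraicComplexity

universe u v

section BlockPath

variable {A : Type*} [Semiring A] {W : Type*} [Fintype W] [DecidableEq W] {d : ℕ}

/-- **Walks in the layered program `{0, …, d} × W`.** Let `N` be the block-superdiagonal matrix
on `Fin (d + 1) × W` whose block `(i, i + 1)` is `M' i`.  Then the `k`-th power of `N` has
`((i, u), (i', v))` entry `(M'_i M'_{i+1} ⋯ M'_{i+k-1})_{u v}` if `i' = i + k` and `0` otherwise.
[cite: Valiant1979, §2] -/
theorem blockPath_pow_apply (M' : ℕ → Matrix W W A) (k : ℕ) (i i' : Fin (d + 1)) (u v : W) :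
    ((Matrix.of fun p q : Fin (d + 1) × W =>
        if q.1.val = p.1.val + 1 then M' p.1.val p.2 q.2 else 0) ^ k) (i, u) (i', v) =
      if i'.val = i.val + k then (((List.range k).map fun s => M' (i.val + s)).prod) u v else 0 := by
  induction k generalizing i' v with
  | zero =>
    rw [pow_zero, List.range_zero, List.map_nil, List.prod_nil, add_zero, Matrix.one_apply,
      Matrix.one_apply]
    by_cases h : i'.val = i.val
    · have hi : i' = i := Fin.ext h
      subst hi
      rw [if_pos rfl]
      by_cases huv : u = v
      · subst huv
        rw [if_pos rfl, if_pos rfl]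
      · rw [if_neg huv, if_neg]
        intro h'
        exact huv (Prod.ext_iff.mp h').2
    · rw [if_neg h, if_neg]
      intro h'
      exact h (congrArg (fun p : Fin (d + 1) × W => p.1.val) h').symm
  | succ k ih =>
    rw [pow_succ, Matrix.mul_apply, Fintype.sum_prod_type]
    simp only [ih, Matrix.of_apply]
    by_cases h : i'.val = i.val + (k + 1)
    · rw [if_pos h]
      have hlt : i.val + k < d + 1 := by have := i'.isLt; omega
      rw [Finset.sum_eq_single (⟨i.val + k, hlt⟩ : Fin (d + 1))]
      · rw [List.range_succ, List.map_append, List.prod_append, List.map_singleton,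
          List.prod_singleton, Matrix.mul_apply]
        refine Finset.sum_congr rfl fun w _ => ?_
        rw [if_pos rfl, if_pos (by show i'.val = i.val + k + 1; omega)]
      · intro j _ hj
        refine Finset.sum_eq_zero fun w _ => ?_
        by_cases hj' : j.val = i.val + k
        · exact absurd (Fin.ext hj') hj
        · rw [if_neg hj', zero_mul]
      · intro hmem
        exact absurd (Finset.mem_univ _) hmem
    · rw [if_neg h]
      refine Finset.sum_eq_zero fun j _ => Finset.sum_eq_zero fun w _ => ?_
      by_cases hj : j.val = i.val + k
      · rw [if_pos hj, if_neg (by omega), mul_zero]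
      · rw [if_neg hj, zero_mul]

end BlockPath

section ListProd

variable {R : Type u} [CommRing R] {ι : Type v} {W : Type} [Fintype W] [DecidableEq W] {d : ℕ}

/-- **An entry of an iterated product of affine matrices is computed by a layered ABP on
`(d + 1) · |W|` vertices** (vertex set `{0, …, d} × W`, block `(t, t + 1)` = `M_t`; the program
is layered by the first coordinate; its unique-length path sum from `(0, u)` to `(d, v)` is
`(M_0 ⋯ M_{d-1})_{u v}` by `blockPath_pow_apply`).  Holds over every commutative ring of
coefficients — here it will be a coefficient ALGEBRA `R`. [cite: Valiant1979, §2] -/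
theorem layeredABPComputes_listProd_apply (M : Fin d → Matrix W W (MvPolynomial ι R))
    (hM : ∀ t u v, (M t u v).totalDegree ≤ 1) (u v : W) :
    LayeredABPComputes ((d + 1) * Fintype.card W) (((List.ofFn M).prod) u v) := by
  classical
  let M' : ℕ → Matrix W W (MvPolynomial ι R) := fun s => if h : s < d then M ⟨s, h⟩ else 1
  let N : Matrix (Fin (d + 1) × W) (Fin (d + 1) × W) (MvPolynomial ι R) :=
    Matrix.of fun p q => if q.1.val = p.1.val + 1 then M' p.1.val p.2 q.2 else 0
  have hlay : ∀ p q, N p q ≠ 0 → q.1.val = p.1.val + 1 := by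
    intro p q h
    by_contra hne
    exact h (by simp only [N, Matrix.of_apply, if_neg hne])
  have hdeg : ∀ p q, (N p q).totalDegree ≤ 1 := by
    intro p q
    simp only [N, Matrix.of_apply]
    split_ifs with h
    · simp only [M']
      split_ifs with h'
      · exact hM _ _ _
      · rw [Matrix.one_apply]
        split_ifs
        · rw [totalDegree_one]; exact Nat.zero_le _
        · rw [totalDegree_zero]; exact Nat.zero_le _
    · rw [totalDegree_zero]; exact Nat.zero_le _
  have h := SumProductABP.layeredABPComputes_of_adjacency (fun p : Fin (d + 1) × W => p.1.val)
    ((0 : Fin (d + 1)), u) (Fin.last d, v) N hlay hdeg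
  have hcard : Fintype.card (Fin (d + 1) × W) = (d + 1) * Fintype.card W := by
    rw [Fintype.card_prod, Fintype.card_fin]
  have hM' : ∀ (s : ℕ) (hs : s < d), M' s = M ⟨s, hs⟩ := fun s hs => dif_pos hs
  have hlist : ((List.range d).map fun s => M' ((0 : Fin (d + 1)).val + s)) = List.ofFn M := by
    refine List.ext_getElem (by simp) fun s h1 h2 => ?_
    have hs : s < d := by simpa using h2
    rw [List.getElem_map, List.getElem_range, List.getElem_ofFn, Fin.val_zero, zero_add]
    exact hM' s hs
  have hpow : (N ^ ((Fin.last d).val - (0 : Fin (d + 1)).val)) ((0 : Fin (d + 1)), u)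
      (Fin.last d, v) = ((List.ofFn M).prod) u v := by
    rw [Fin.val_zero, Nat.sub_zero, Fin.val_last]
    rw [show N ^ d = (Matrix.of fun p q : Fin (d + 1) × W =>
        if q.1.val = p.1.val + 1 then M' p.1.val p.2 q.2 else 0) ^ d from rfl,
      blockPath_pow_apply M' d 0 (Fin.last d) u v,
      if_pos (by rw [Fin.val_last, Fin.val_zero, zero_add]), hlist]
  rw [hcard, hpow] at h
  exact h

/-- **Read-out of an iterated matrix product over a coefficient algebra.** Let `R` be a
commutative `k`-algebra of dimension `≤ s`, `λ : R → k` linear, `M_0, …, M_{d-1}` matrices of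
affine forms over `R` on an index set `W`, and `f = λ_* ((M_0 ⋯ M_{d-1})_{u v})` coefficientwise.
Then `f` has a `((d + 1) |W| + 1, s)`-representation.  (Non-commuting counterpart of
`hasAlgDetRepr_entry_prod_of_commute`: matrix size `≈ d |W|` instead of `d`, but the coefficient
dimension stays `s` instead of growing to `s |W|²`.) [cite: Valiant1979, §2] -/
theorem hasAlgDetRepr_listProd_apply_readOut {k : Type u} [Field k] {σ : Type v}
    {f : MvPolynomial σ k} {s : ℕ} (S : Type u) [CommRing S] [Algebra k S] [Module.Finite k S]
    (hS : Module.finrank k S ≤ s) (l : S →ₗ[k] k)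
    (M : Fin d → Matrix W W (MvPolynomial σ S)) (hM : ∀ t u v, (M t u v).totalDegree ≤ 1)
    (u v : W) (hf : ∀ e : σ →₀ ℕ, l (coeff e (((List.ofFn M).prod) u v)) = coeff e f) :
    HasAlgDetRepr f ((d + 1) * Fintype.card W + 1) s :=
  hasAlgDetRepr_of_layeredABP_readOut S hS l (layeredABPComputes_listProd_apply M hM u v) hf

end ListProd

end Summit.ValiantsHypothesis.ValiantsHypothesis.Theorems.GrenetZeonPolySizeQPAlgebra

end
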